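import Mathlib
import HarnessLib
import Literature.Analysis.FluidPDE.TypeIRateOseenMildRepresentative
import Literature.Analysis.FluidPDE.KNSSTypeIRateLiouvilleMild

/-!
# Route HardyPointSink — support `ABForwardHardy` (item stmt-NavierStokesRegularity-7983), file 10:
# bounded suitable weak solutions with `𝐈 < ∞` on the backward slab are mild bounded ancient
# solutions

Tenth helper file for the forward direction of Albritton–Barker 2019, Thm. 1.1 (the sentence
"such a solution … gives rise to a non-trivial mild bounded ancient solution", A–B §3, and
Remark 2.9 of Seregin–Šverák 2009: "the main point of the theorem is that the limit `u` is a
mild solution, i.e., the parasitic solutions cannot appear in this re-scaling procedure").  The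
tree's `exists_oseenMild_repr_of_typeIBound_lt_top` proves this for slab solutions with a
Type-I *rate*; here is the variant for slab solutions bounded by a constant `B`
(`exists_oseenMild_repr_of_bounded`) — same proof (windows `(−(n+2), −1/(n+2))`, the tree's
`exists_oseenMild_repr_window`, i.e. KNSS 2009 Lemma 3.1 with the parasitic drift killed by the
`A`-part of `𝐈`, and gluing of the continuous window representatives), with the rate replaced by
the bound — and its packaging as the accepted duality-form class
`IsBoundedAncientMildSolution 1` through the tree's `isBoundedAncientMildSolution_of_oseen`
(`exists_boundedAncientMild_repr`).

## References

* D. Albritton, T. Barker, J. Math. Fluid Mech. 21 (2019) = arXiv:1811.00502, Thm. 1.1, §3.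
* G. Koch, N. Nadirashvili, G. Seregin, V. Šverák, Acta Math. 203 (2009), Lemma 3.1, §4 (i).
* G. Seregin, V. Šverák, Comm. PDE 34 (2009) = arXiv:0804.1803, Thm. 2.8, Remark 2.9.
-/

noncomputable section

open MeasureTheory Set Function Filter Metric TopologicalSpace
open _root_.Topology
open scoped NNReal ENNReal
open Literature.Analysis Literature.Analysis.FluidPDE

-- single-problem summit: the namespace repeats the summit name by design (CONVENTIONS §1)
set_option linter.dupNamespace false

namespace Summit.NavierStokesRegularity.NavierStokesRegularity.Theorems.HardyPointSinkABForwardHardy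

local notation "ℝ³" => EuclideanSpace ℝ (Fin 3)

/-- **Bounded suitable weak solutions with `𝐈 < ∞` on the backward slab are continuous ancient
Oseen-mild fields** (variant of the tree's `exists_oseenMild_repr_of_typeIBound_lt_top` with the
Type-I rate replaced by a uniform bound). [cite: AlbrittonBarker2019, Thm 1.1 (forward direction, §3), with KochNadirashviliSereginSverak2009 Lemma 3.1 and §4 (i)] -/
theorem exists_oseenMild_repr_of_bounded {u : ℝ → ℝ³ → ℝ³} {p : ℝ → ℝ³ → ℝ}
    {G : ℝ → ℝ³ → ℝ³ →L[ℝ] ℝ³} {B : ℝ}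
    (hsw : IsSuitableWeakSolutionOn (slab ℝ³ (Iio 0) isOpen_Iio) 1 0 u p)
    (hB : ∀ t < 0, ∀ x, ‖u t x‖ ≤ B)
    (hI : typeIBound (Iio (0 : ℝ) ×ˢ (univ : Set ℝ³)) u p G < ∞) :
    ∃ v : ℝ → ℝ³ → ℝ³,
      (∀ᵐ w ∂(volume.restrict (Iio (0 : ℝ) ×ˢ (univ : Set ℝ³))), uncurry u w = uncurry v w) ∧
      ContinuousOn (uncurry v) (Iio 0 ×ˢ univ) ∧
      (∀ t < 0, IsWeaklyDivFree (v t)) ∧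
      (∀ s t : ℝ, s < t → t < 0 → ∀ x,
        v t x = UnboundedOperators.heatExtension (v s) (t - s) x - oseenDuhamel 1 s v v t x) ∧
      (∀ t < 0, ∀ x, ‖v t x‖ ≤ B) := by
  -- ## constants
  set I : ℝ := (typeIBound (Iio (0 : ℝ) ×ˢ (univ : Set ℝ³)) u p G).toReal with hIdef
  have hI0 : 0 ≤ I := ENNReal.toReal_nonneg
  have hIle : typeIBound (Iio (0 : ℝ) ×ˢ (univ : Set ℝ³)) u p G ≤ ENNReal.ofReal I :=
    (ENNReal.ofReal_toReal hI.ne).symm.le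
  -- ## the windows `W n = (−(n+2), −1/(n+2))`
  set a : ℕ → ℝ := fun n => -((n : ℝ) + 2) with ha
  set c : ℕ → ℝ := fun n => -(1 / ((n : ℝ) + 2)) with hc
  have hc0 : ∀ n, c n < 0 := fun n => by rw [hc]; dsimp only; rw [neg_lt_zero]; positivity
  have hac : ∀ n, a n < c n := fun n => by
    rw [ha, hc]; dsimp only
    have hn : (2 : ℝ) ≤ (n : ℝ) + 2 := by linarith [(Nat.cast_nonneg n : (0 : ℝ) ≤ n)]
    have h1 : 1 / ((n : ℝ) + 2) ≤ 1 / 2 := div_le_div_of_nonneg_left zero_le_one two_pos hn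
    linarith
  have hanti : ∀ {k m : ℕ}, k ≤ m → a m ≤ a k := fun {k m} hkm => by
    rw [ha]; dsimp only
    have : (k : ℝ) ≤ m := by exact_mod_cast hkm
    linarith
  have hcmono : ∀ {k m : ℕ}, k ≤ m → c k ≤ c m := fun {k m} hkm => by
    rw [hc]; dsimp only
    have : (k : ℝ) ≤ m := by exact_mod_cast hkm
    have h1 : 1 / ((m : ℝ) + 2) ≤ 1 / ((k : ℝ) + 2) :=
      div_le_div_of_nonneg_left zero_le_one (by positivity) (by linarith)
    linarith
  have hnest : ∀ {k m : ℕ}, k ≤ m → Ioo (a k) (c k) ⊆ Ioo (a m) (c m) := fun hkm t ht =>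
    ⟨(hanti hkm).trans_lt ht.1, ht.2.trans_le (hcmono hkm)⟩
  -- suitable weak, bounded, and Morrey on each window
  have hswn : ∀ n, IsSuitableWeakSolutionOn (slab ℝ³ (Ioo (a n) (c n)) isOpen_Ioo) 1 0 u p :=
    fun n => hsw.of_le (slab_mono fun t ht => ht.2.trans (hc0 n))
  have hMn : ∀ n, ∀ t ∈ Ioo (a n) (c n), ∀ x, ‖u t x‖ ≤ B := fun n t ht x =>
    hB t (ht.2.trans (hc0 n)) x
  have hMorn : ∀ n, ∀ᵐ t ∂(volume.restrict (Ioo (a n) (c n))), ∀ m : ℕ, n + 2 ≤ m →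
      ∫⁻ y in ball (0 : ℝ³) m, ‖u t y‖ₑ ^ 2 ≤ ENNReal.ofReal (I * m) := by
    intro n
    rw [ae_all_iff]
    intro m
    by_cases hm : n + 2 ≤ m
    · have hmpos : 0 < (m : ℝ) := by exact_mod_cast (show 0 < m by omega)
      have hm2 : (n : ℝ) + 2 ≤ m := by exact_mod_cast hm
      have hsub : Ioo (a n) (c n) ⊆ Ioo (-(m : ℝ) ^ 2) 0 := fun t ht =>
        ⟨lt_of_le_of_lt (by rw [ha] at ht; nlinarith) ht.1, ht.2.trans (hc0 n)⟩
      exact (ae_restrict_of_ae_restrict_of_subset hsub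
        (ae_lintegral_ball_sq_le_of_typeIBound hIle hmpos)).mono fun t ht _ => ht
    · exact Eventually.of_forall fun t h => absurd h hm
  -- ## the window representatives and their agreement on overlaps
  choose v hvc hvd hvm hvae using fun n =>
    exists_oseenMild_repr_window (hac n) (hswn n) (hMn n) hI0 (hMorn n)
  have hagree : ∀ k n, EqOn (uncurry (v k)) (uncurry (v n))
      ((Ioo (a k) (c k) ∩ Ioo (a n) (c n)) ×ˢ (univ : Set ℝ³)) := by
    intro k n
    have hO : IsOpen ((Ioo (a k) (c k) ∩ Ioo (a n) (c n)) ×ˢ (univ : Set ℝ³)) :=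
      (isOpen_Ioo.inter isOpen_Ioo).prod isOpen_univ
    refine Measure.eqOn_open_of_ae_eq (μ := (volume : Measure (ℝ × ℝ³))) ?_ hO
      ((hvc k).mono (prod_mono inter_subset_left Subset.rfl))
      ((hvc n).mono (prod_mono inter_subset_right Subset.rfl))
    have hs1 : (Ioo (a k) (c k) ∩ Ioo (a n) (c n)) ×ˢ (univ : Set ℝ³) ⊆ Ioo (a k) (c k) ×ˢ univ :=
      prod_mono inter_subset_left Subset.rfl
    have hs2 : (Ioo (a k) (c k) ∩ Ioo (a n) (c n)) ×ˢ (univ : Set ℝ³) ⊆ Ioo (a n) (c n) ×ˢ univ :=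
      prod_mono inter_subset_right Subset.rfl
    have h1 := ae_restrict_of_ae_restrict_of_subset hs1 (hvae k)
    have h2 := ae_restrict_of_ae_restrict_of_subset hs2 (hvae n)
    filter_upwards [h1, h2] with w hw1 hw2
    rw [← hw1, ← hw2]
  -- ## the index of a window containing a given negative time
  set idx : ℝ → ℕ := fun t => ⌈-t⌉₊ + ⌈1 / (-t)⌉₊ with hidxdef
  have hidx : ∀ t < 0, t ∈ Ioo (a (idx t)) (c (idx t)) := by
    intro t ht
    have ht0 : 0 < -t := neg_pos.2 ht
    have h1 : -t ≤ (⌈-t⌉₊ : ℝ) := Nat.le_ceil _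
    have h2 : 1 / (-t) ≤ (⌈1 / (-t)⌉₊ : ℝ) := Nat.le_ceil _
    have hk : ((idx t : ℕ) : ℝ) = (⌈-t⌉₊ : ℝ) + ⌈1 / (-t)⌉₊ := by
      rw [hidxdef]; dsimp only; rw [Nat.cast_add]
    have hn1 : (0 : ℝ) ≤ ⌈-t⌉₊ := Nat.cast_nonneg _
    have hn2 : (0 : ℝ) ≤ ⌈1 / (-t)⌉₊ := Nat.cast_nonneg _
    constructor
    · show -(((idx t : ℕ) : ℝ) + 2) < t
      rw [hk]; linarith
    · show t < -(1 / (((idx t : ℕ) : ℝ) + 2))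
      rw [hk]
      have hpos : (0 : ℝ) < (⌈-t⌉₊ : ℝ) + ⌈1 / (-t)⌉₊ + 2 := by positivity
      have hK : 1 / (-t) < (⌈-t⌉₊ : ℝ) + ⌈1 / (-t)⌉₊ + 2 := by linarith
      rw [div_lt_iff₀ ht0] at hK
      rw [lt_neg, div_lt_iff₀ hpos]
      linarith
  -- ## the representative
  set w : ℝ → ℝ³ → ℝ³ := fun t x => v (idx t) t x with hwdef
  have hloc : ∀ n, ∀ t ∈ Ioo (a n) (c n), ∀ x, w t x = v n t x := fun n t ht x =>
    hagree (idx t) n (x := (t, x)) ⟨⟨hidx t (ht.2.trans (hc0 n)), ht⟩, mem_univ _⟩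
  -- `u = w` a.e. on the slab
  have haew : ∀ᵐ z ∂(volume.restrict (Iio (0 : ℝ) ×ˢ (univ : Set ℝ³))), uncurry u z = uncurry w z := by
    have hcover : Iio (0 : ℝ) ×ˢ (univ : Set ℝ³) ⊆ ⋃ n, Ioo (a n) (c n) ×ˢ (univ : Set ℝ³) :=
      fun z hz => mem_iUnion.2 ⟨idx z.1, hidx z.1 hz.1, mem_univ _⟩
    refine ae_restrict_of_ae_restrict_of_subset hcover ((ae_restrict_iUnion_iff _ _).2 fun n => ?_)
    filter_upwards [hvae n, ae_restrict_mem (measurableSet_Ioo.prod MeasurableSet.univ)]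
      with z hz hzI
    rw [hz]
    exact (hloc n z.1 hzI.1 z.2).symm
  refine ⟨w, haew, ?_, fun t ht => hvd (idx t) t (hidx t ht), fun s t hst ht x => ?_, fun t ht x => ?_⟩
  · -- continuity on the open slab
    rintro ⟨t, x⟩ ⟨ht, -⟩
    have hW : Ioo (a (idx t)) (c (idx t)) ×ˢ (univ : Set ℝ³) ∈ 𝓝 (t, x) :=
      (isOpen_Ioo.prod isOpen_univ).mem_nhds ⟨hidx t ht, mem_univ _⟩
    have heq : EqOn (uncurry w) (uncurry (v (idx t))) (Ioo (a (idx t)) (c (idx t)) ×ˢ univ) :=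
      fun z hz => hloc (idx t) z.1 hz.1 z.2
    exact (((hvc (idx t)).congr heq).continuousAt hW).continuousWithinAt
  · -- the Oseen identity, inside one window containing `s` and `t`
    have hs : s < 0 := hst.trans ht
    set m : ℕ := max (idx s) (idx t) with hm
    have hsW : s ∈ Ioo (a m) (c m) := hnest (le_max_left _ _) (hidx s hs)
    have htW : t ∈ Ioo (a m) (c m) := hnest (le_max_right _ _) (hidx t ht)
    have h1 := hvm m s t hsW.1 hst htW.2 x
    have e1 : w t x = v m t x := hloc m t htW x
    have e2 : w s = v m s := funext (hloc m s hsW)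
    have e3 : oseenDuhamel 1 s w w t x = oseenDuhamel 1 s (v m) (v m) t x := by
      simp only [oseenDuhamel_apply]
      refine setIntegral_congr_fun measurableSet_Ioo fun σ hσ => ?_
      have hσW : σ ∈ Ioo (a m) (c m) := ⟨hsW.1.trans hσ.1, hσ.2.trans htW.2⟩
      have e : w σ = v m σ := funext (hloc m σ hσW)
      rw [e]
    rw [e1, e2, e3]
    exact h1
  · -- the bound passes from `u` (a.e.) to the continuous `w` (everywhere)
    set g : ℝ × ℝ³ → ℝ := fun z => min (B - ‖w z.1 z.2‖) 0 with hg
    have hwc : ContinuousOn (uncurry w) (Iio 0 ×ˢ univ) := by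
      rintro ⟨t', x'⟩ ⟨ht', -⟩
      have hW : Ioo (a (idx t')) (c (idx t')) ×ˢ (univ : Set ℝ³) ∈ 𝓝 (t', x') :=
        (isOpen_Ioo.prod isOpen_univ).mem_nhds ⟨hidx t' ht', mem_univ _⟩
      have heq : EqOn (uncurry w) (uncurry (v (idx t'))) (Ioo (a (idx t')) (c (idx t')) ×ˢ univ) :=
        fun z hz => hloc (idx t') z.1 hz.1 z.2
      exact (((hvc (idx t')).congr heq).continuousAt hW).continuousWithinAt
    have hgc : ContinuousOn g (Iio 0 ×ˢ univ) := by
      have h2 : ContinuousOn (fun z : ℝ × ℝ³ => B - ‖w z.1 z.2‖) (Iio 0 ×ˢ univ) :=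
        continuousOn_const.sub hwc.norm
      exact continuous_min.comp_continuousOn (h2.prodMk continuousOn_const)
    have hg0 : g =ᵐ[volume.restrict (Iio (0 : ℝ) ×ˢ (univ : Set ℝ³))] fun _ => 0 := by
      filter_upwards [haew, ae_restrict_mem (measurableSet_Iio.prod MeasurableSet.univ)] with z hz hzI
      have hb : ‖w z.1 z.2‖ ≤ B := by
        have e : w z.1 z.2 = u z.1 z.2 := (show uncurry u z = uncurry w z from hz).symm
        rw [e]
        exact hB z.1 hzI.1 z.2
      show min (B - ‖w z.1 z.2‖) 0 = 0
      exact min_eq_right (sub_nonneg.2 hb)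
    have hEq := Measure.eqOn_open_of_ae_eq hg0 (isOpen_Iio.prod isOpen_univ) hgc continuousOn_const
    have h := hEq (x := (t, x)) ⟨ht, mem_univ _⟩
    have h' : 0 ≤ B - ‖w t x‖ := min_eq_right_iff.1 h
    linarith

/-- **… hence mild bounded ancient solutions in the accepted duality form** with continuous
(so measurable) slices: the Oseen-mild representative of `exists_oseenMild_repr_of_bounded`
packaged by the tree's `isBoundedAncientMildSolution_of_oseen` (KNSS 2009, §4 (i)).
[cite: KochNadirashviliSereginSverak2009, §4 (i); AlbrittonBarker2019, §3] -/
theorem exists_boundedAncientMild_repr {u : ℝ → ℝ³ → ℝ³} {p : ℝ → ℝ³ → ℝ}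
    {G : ℝ → ℝ³ → ℝ³ →L[ℝ] ℝ³} {B : ℝ}
    (hsw : IsSuitableWeakSolutionOn (slab ℝ³ (Iio 0) isOpen_Iio) 1 0 u p)
    (hB : ∀ t < 0, ∀ x, ‖u t x‖ ≤ B)
    (hI : typeIBound (Iio (0 : ℝ) ×ˢ (univ : Set ℝ³)) u p G < ∞) :
    ∃ v : ℝ → ℝ³ → ℝ³,
      (∀ᵐ w ∂(volume.restrict (Iio (0 : ℝ) ×ˢ (univ : Set ℝ³))), uncurry u w = uncurry v w) ∧
      ContinuousOn (uncurry v) (Iio 0 ×ˢ univ) ∧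
      IsBoundedAncientMildSolution 1 v := by
  obtain ⟨v, hae, hvc, hvd, hvm, hvB⟩ := exists_oseenMild_repr_of_bounded hsw hB hI
  refine ⟨v, hae, hvc, isBoundedAncientMildSolution_of_oseen one_pos hvc ⟨B, hvB⟩ hvd ?_⟩
  intro s t hst ht x
  rw [one_mul]
  exact hvm s t hst ht x

end Summit.NavierStokesRegularity.NavierStokesRegularity.Theorems.HardyPointSinkABForwardHardy

end
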